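import Summits.ResolutionOfSingularities.ResolutionOfSingularities.Theorems.WeightedInvariantContactCylinderTorusFactorFlatT
import Summits.ResolutionOfSingularities.ResolutionOfSingularities.Theorems.WeightedInvariantIota3SigmaDescentSX
import HarnessLib

/-!
# (c10)≤3 for `ι₃ᵗ = Iota3.iotaFlatT`: the `σ`-input discharged by res-type-057's generic-fibre descent MODULO the specialisation
# of flags — (o44) part (c10-cyl), layer 3′ (door `HypersurfaceCentreConstruction`, stmt-ResolutionOfSingularities-19897; rung P3
# `stub_keyRungLE_three`; res-type-005 with res-type-057 ANSWER 2026-08-27T15:01:08Z)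

Topic: `Summits/ResolutionOfSingularities/ResolutionOfSingularities/Theorems`. Helper for the door item
`HypersurfaceCentreConstruction` (stmt-ResolutionOfSingularities-19897, route `WeightedInvariant`), def-free.  In
`Iota3.iotaFlatT_torusFactorMonotoneLE` (p541814) the input `hσ : σ (T[X]_{𝔪_T T[X]}) (g) ≤ σ T g` is replaced by
res-type-057's `Iota3.iotaSigma_genericFibre_eq_of_spec` (p538474: `σ` is PRESERVED along `T → T(X)` modulo the specialisation
of two-flags `hspec`, true for infinite residue fields — res-type-057 (D-b)(5), in progress).  Remaining named inputs:
`h10τ` ((c10) for `ι₃ᵘ`, res-type-013 (o49)), `hgenτ` (generic-fibre equality for `ι₃ᵘ`), `hspec` (pointwise in `T`).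

[OURS · L1 W4.3 · (o44) (c10-cyl) layer 3′]  Replaces the role of NO printed item; NOT a statement of the manuscript
[claim: Hironaka2017, status: under-review]. AI work, weaker than expert review.

## References

* H. Matsumura, Commutative Ring Theory (1987), Thm. 4.3. [Matsumura1987]
* res-type-057, ANSWER 2026-08-27T15:01:08Z and plan/tools/res-type-057/SIGMA-DESCENT-SX.md (OURS, AI analysis).
-/

noncomputable section

open IsLocalRing Literature.AlgebraicGeometry.Resolution Polynomial
open Summit.ResolutionOfSingularities.ResolutionOfSingularities.Theorems
open Summit.ResolutionOfSingularities.ResolutionOfSingularities.Theorems.ContactCylinder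

set_option linter.dupNamespace false -- mandated namespace of this single-conjunct summit

namespace Summit.ResolutionOfSingularities.ResolutionOfSingularities.Cruxes.HypersurfaceCentreConstruction.LocalEngine

namespace Iota3

/-- **`IotaTorusFactorMonotoneLE 3 p Iota3.iotaFlatT` MODULO `h10τ`, `hgenτ` and the SPECIALISATION OF FLAGS `hspec`** (pointwise at
the regular local rings `T` of dimension `≤ 3`; res-type-057's `iotaSigma_genericFibre_eq_of_spec` supplies the `σ`-input).
[OURS · L1 W4.3 · (o44) (c10-cyl)] -/
theorem iotaFlatT_torusFactorMonotoneLE_of_spec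
    (h10τ : ∀ (T : Type) [CommRing T] [IsRegularLocalRing T] (g : T) (𝔮₁ : Ideal T[X]) [𝔮₁.IsPrime],
      ringKrullDim T ≤ 3 → 𝔮₁.comap (C : T →+* T[X]) = maximalIdeal T →
      iotaOrdEpsTau (Localization.AtPrime 𝔮₁) (algebraMap T[X] (Localization.AtPrime 𝔮₁) (C g)) ≤ iotaOrdEpsTau T g)
    (hgenτ : ∀ (T : Type) [CommRing T] [IsRegularLocalRing T] (g : T)
      [((maximalIdeal T).map (C : T →+* T[X])).IsPrime], ringKrullDim T ≤ 3 →
      iotaOrdEpsTau (Localization.AtPrime ((maximalIdeal T).map (C : T →+* T[X])))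
        (algebraMap T[X] (Localization.AtPrime ((maximalIdeal T).map (C : T →+* T[X]))) (C g)) = iotaOrdEpsTau T g)
    (hspec : ∀ (T : Type) [CommRing T] [IsRegularLocalRing T], ringKrullDim T ≤ 3 → ∀ G₁ G₂ : T[X],
      IsTwoFlag (algebraMap T[X] (Localization.AtPrime ((maximalIdeal T).map (C : T →+* T[X]))) G₁)
        (algebraMap T[X] (Localization.AtPrime ((maximalIdeal T).map (C : T →+* T[X]))) G₂) →
      ∀ B : Finset (ResidueField T), ∃ a : T, residue T a ∉ B ∧ IsTwoFlag (Polynomial.aeval a G₁) (Polynomial.aeval a G₂))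
    (p : ℕ) : IotaTorusFactorMonotoneLE 3 p iotaFlatT :=
  iotaFlatT_torusFactorMonotoneLE h10τ hgenτ
    (fun T _ _ g _ hd => (iotaSigma_genericFibre_eq_of_spec (hspec T hd) g).le) p

end Iota3

end Summit.ResolutionOfSingularities.ResolutionOfSingularities.Cruxes.HypersurfaceCentreConstruction.LocalEngine

end
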